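import Summits.ValiantsHypothesis.ValiantsHypothesis.Theorems.GrenetZeonDualUnipotentThreeHalvesLongMassRankR
import Summits.ValiantsHypothesis.ValiantsHypothesis.Theorems.GrenetZeonDualUnipotentThreeHalvesLongMassLedgerTorus

/-!
# `GrenetZeon.DualUnipotentThreeHalves` (stmt-ValiantsHypothesis-24318), line `slow_core`, stub `stub_longMassSlowLawInv` ((c)):
# the per-coordinate census instrument at order `k` counts only coordinates of coefficient-RANK `> k`

By-name corollary of ✓ `LongMassRankR.totalDegree_pow_map_lineSubst_le_of_factor` / `exists_factor_of_rank` (p817721 / its §5 append) in the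
currency of the census kill of record ✓ `InitialForm.LedgerTorus.not_relCert_of_count` (val-idea-28 g5), generalising g0's rank-one/rank-two reading
✓ `LongMassRankOne.count_criterion_needs_rankTwo` (p814772) to every order: a coordinate `e` whose coefficient matrix `[x_e] N` has rank `≤ k` lies
in the WINDOW CONE of order `k` (`windowCone_single_of_rank_le`); hence at every order `k` the coordinates outside the window cone are among the
coordinates of coefficient-rank `> k` (`card_not_windowCone_le_card_rank_gt`), and the count hypothesis of `not_relCert_of_count` at price `P`
forces `P < n·k + #{e : rank [x_e]N > k}` for EVERY `k` (`count_criterion_needs_rank`).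
ENEMY-SPEC READING (crit-7 V34 §2): a (c)-violator family certified by the count instrument at price `c·√n·b` carries, for every order `k`, more than
`c·√n·b − n·k` coordinates whose coefficient matrices have rank `> k`; at `k = ⌊c·b/(2√n)⌋` still more than `c·√n·b/2` coordinates of rank
`> c·b/(2√n)`.  Honest framing: bookkeeping on an instrument; NOT progress on (c) `SlowCore.LongMassSlowLawInv`; (c), S3, 24318, 8062, VP ≠ VNP
OPEN / NOT proved.  No sorry, no definitions, no named facts.
-/

-- single-conjunct layout: Sub = Summit, duplicated namespace component intended (the name is mandated)
set_option linter.dupNamespace false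
set_option autoImplicit false

noncomputable section

namespace Summit.ValiantsHypothesis.ValiantsHypothesis.Theorems.GrenetZeon.LongMassRankR

open MvPolynomial Matrix
open Summit.ValiantsHypothesis.ValiantsHypothesis.Cruxes.TwoDimCoefficients.DimTwoCases (AffMat IsAffine)
open Summit.ValiantsHypothesis.ValiantsHypothesis.Theorems.GrenetZeon.RadicalSplit (lineSubst)
open Summit.ValiantsHypothesis.ValiantsHypothesis.Theorems.GrenetZeon.SlowCore (Ledger RelCert linEntry)
open Summit.ValiantsHypothesis.ValiantsHypothesis.Theorems.GrenetZeon.LongMassRankOne (linEntry_single)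
open Summit.ValiantsHypothesis.ValiantsHypothesis.Theorems.GrenetZeon.InitialForm.LedgerTorus (WindowCone not_relCert_of_count)

variable {n m : ℕ}

/-- **A coordinate of coefficient-rank `≤ k` lies in the window cone of order `k`.** [this file] -/
theorem windowCone_single_of_rank_le (N : AffMat n m) (hN : IsAffine N) {H : ℕ} (hnil : N ^ H = 0) (e : Fin n × Fin n)
    {k : ℕ} (hk : (Matrix.of fun i j : Fin m => coeff (Finsupp.single e 1) (N i j)).rank ≤ k) :
    WindowCone N k (Pi.single e (1 : ℂ)) := by
  intro x b _ i j
  obtain ⟨U, W, hUW⟩ := exists_factor_of_rank (Matrix.of fun i j : Fin m => coeff (Finsupp.single e 1) (N i j))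
  have h := totalDegree_pow_map_lineSubst_le_of_factor N hN hnil x (Pi.single e (1 : ℂ)) U W
    (fun i' j' => by rw [linEntry_single, ← hUW, Matrix.of_apply]) b i j
  exact h.trans hk

open Classical in
/-- **The census at order `k` sees only coefficient-rank `> k`**: the coordinates OUTSIDE the window cone of order `k` are among the coordinates
whose coefficient matrix has rank `> k`. [this file] -/
theorem card_not_windowCone_le_card_rank_gt (N : AffMat n m) (hN : IsAffine N) {H : ℕ} (hnil : N ^ H = 0) (k : ℕ) :
    (Finset.univ.filter fun e : Fin n × Fin n => ¬ WindowCone N k (Pi.single e (1 : ℂ))).card ≤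
      (Finset.univ.filter fun e : Fin n × Fin n =>
        k < (Matrix.of fun i j : Fin m => coeff (Finsupp.single e 1) (N i j)).rank).card := by
  refine Finset.card_le_card fun e he => ?_
  rw [Finset.mem_filter] at he ⊢
  refine ⟨he.1, lt_of_not_ge fun hle => he.2 (windowCone_single_of_rank_le N hN hnil e hle)⟩

open Classical in
/-- Complement count: `n² − #cone_k ≤ #{e : rank [x_e]N > k}`. [this file] -/
theorem sq_sub_card_windowCone_le_card_rank_gt (N : AffMat n m) (hN : IsAffine N) {H : ℕ} (hnil : N ^ H = 0) (k : ℕ) :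
    n * n - (Finset.univ.filter fun e : Fin n × Fin n => WindowCone N k (Pi.single e (1 : ℂ))).card ≤
      (Finset.univ.filter fun e : Fin n × Fin n =>
        k < (Matrix.of fun i j : Fin m => coeff (Finsupp.single e 1) (N i j)).rank).card := by
  have hsplit := Finset.card_filter_add_card_filter_not
    (s := (Finset.univ : Finset (Fin n × Fin n))) (fun e : Fin n × Fin n => WindowCone N k (Pi.single e (1 : ℂ)))
  rw [Finset.card_univ, Fintype.card_prod, Fintype.card_fin] at hsplit
  have h := card_not_windowCone_le_card_rank_gt N hN hnil k
  omega

open Classical in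
/-- ★ **THE COUNT CRITERION NEEDS RANK `> k` AT EVERY ORDER `k`.**  If the hypothesis of ✓ `not_relCert_of_count` holds at price `P` (for every
order `k` the coordinate count already exceeds `P`), then `P < n·k + #{e : rank [x_e]N > k}` for every `k`: a violator certified by the
per-coordinate census at price `c·√n·b` has, at each order `k`, more than `c·√n·b − n·k` coordinates of coefficient-rank `> k`.
(`k = 1`: ✓ `LongMassRankOne.count_criterion_needs_rankTwo`.) [this file] -/
theorem count_criterion_needs_rank (N : AffMat n m) (hN : IsAffine N) {H : ℕ} (hnil : N ^ H = 0) (P : ℕ)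
    (hcount : ∀ k : ℕ,
      P < n * k + (n * n - (Finset.univ.filter fun e : Fin n × Fin n => WindowCone N k (Pi.single e (1 : ℂ))).card))
    (k : ℕ) :
    P < n * k + (Finset.univ.filter fun e : Fin n × Fin n =>
        k < (Matrix.of fun i j : Fin m => coeff (Finsupp.single e 1) (N i j)).rank).card := by
  have h1 := hcount k
  have h2 := sq_sub_card_windowCone_le_card_rank_gt N hN hnil k
  omega

open Classical in
/-- The same read as a NECESSARY CONDITION for a census kill: if at SOME order `k` at most `P − n·k` coordinates have coefficient-rank `> k`
(precisely `n·k + #{e : rank [x_e]N > k} ≤ P`), the count hypothesis of `not_relCert_of_count` FAILS, so the instrument cannot certify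
`¬ RelCert n m N P`. [this file] -/
theorem not_count_of_few_rank_gt (N : AffMat n m) (hN : IsAffine N) {H : ℕ} (hnil : N ^ H = 0) (P k : ℕ)
    (hfew : n * k + (Finset.univ.filter fun e : Fin n × Fin n =>
        k < (Matrix.of fun i j : Fin m => coeff (Finsupp.single e 1) (N i j)).rank).card ≤ P) :
    ¬ ∀ k : ℕ,
      P < n * k + (n * n - (Finset.univ.filter fun e : Fin n × Fin n => WindowCone N k (Pi.single e (1 : ℂ))).card) :=
  fun hcount => absurd (count_criterion_needs_rank N hN hnil P hcount k) (not_lt.mpr hfew)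

/-! ## §2 (c)'s conclusion for pencils of bounded coefficient-rank (`K = ⊤`) -/

/-- ★ **BOUNDED COEFFICIENT-RANK PENCILS ARE CERTIFIED AT PRICE `n·r`.**  If EVERY direction of the nilpotent affine pencil `N` has linear
coefficient matrix of rank `≤ r` (equivalently: the linear coefficient space of `N` is a space of matrices of rank `≤ r`), then
`RelCert n m N (n·r)` (`K = ⊤`).  In (c)'s currency: the conclusion `RelCert n b B (c·(√n·b))` of `SlowCore.LongMassSlowLawInv` /
`LongMassSlowLawAll` holds for every nilpotent affine `b × b` pencil whose coefficient space has rank `≤ c·b/√n` — (c)-violators have a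
direction of coefficient-rank `> c·b/√n` (cf. ✓ `LongMassRankOne.relCert_of_rankOne_linearPart`: rank `≤ 1` ⇒ price `3·⌊√n⌋·m` via McCoy;
here rank `≤ r` ⇒ price `n·r` via adjugate minors, no triangularisation). [this file] -/
theorem relCert_of_rank_top (N : AffMat n m) (hN : IsAffine N) {H : ℕ} (hnil : N ^ H = 0) (r : ℕ)
    (h : ∀ v : Fin n × Fin n → ℂ, (Matrix.of fun i j => linEntry N i j v).rank ≤ r) :
    RelCert n m N (n * r) := by
  have h1 := relCert_of_rank N hN hnil ⊤ (fun v _ => h v)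
  have hfin : Module.finrank ℂ (⊤ : Submodule ℂ (Fin n × Fin n → ℂ)) = n * n := by
    rw [finrank_top, Module.finrank_pi ℂ, Fintype.card_prod, Fintype.card_fin]
  rw [hfin, Nat.sub_self, add_zero] at h1
  exact h1

/-- The same in (c)'s literal price shape: coefficient-rank `≤ r` everywhere and `n·r ≤ c·(√n·b)` ⇒ `RelCert n b B (c·(√n·b))`. [this file] -/
theorem relCert_sqrt_of_rank_top (N : AffMat n m) (hN : IsAffine N) {H : ℕ} (hnil : N ^ H = 0) (r c : ℕ)
    (h : ∀ v : Fin n × Fin n → ℂ, (Matrix.of fun i j => linEntry N i j v).rank ≤ r)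
    (hc : n * r ≤ c * (Nat.sqrt n * m)) :
    RelCert n m N (c * (Nat.sqrt n * m)) :=
  Summit.ValiantsHypothesis.ValiantsHypothesis.Theorems.GrenetZeon.Ceilings.relCert_mono (relCert_of_rank_top N hN hnil r h) hc

end Summit.ValiantsHypothesis.ValiantsHypothesis.Theorems.GrenetZeon.LongMassRankR

end
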